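import Mathlib
import Summits.RiemannHypothesis.RiemannHypothesis.Theorems.WeilFormatCDeflatedFarLimit
import Summits.RiemannHypothesis.RiemannHypothesis.Theorems.WeilFormatCDeflatedFarRows
import HarnessLib

/-!
# Format C, design C∞: the coupling clause of the deflated certificate under a kernel envelope

Route context: Fourier–Galerkin / Schur-complement certificates of Weil positivity on a window ("format C";
cell memo `run/shared/lean/pub/rh-explicit/rh-explicit-weil-10/KERNEL-LEVER.md` §18; supporting
stmt-RiemannHypothesis-0098; seat rh-explicit-weil-10).

The limit wrapper `sum_range_mul_mul_nonneg_of_certificate_deflated_limit` asks, for every `ε > 0`, for ONE cut-off `P` at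
which three finite-`P` objects are `ε(Σx² + Σβ²)`-close to their limits; the coupling (`Uq`) clause must hold for EVERY
truncation `N`, i.e. UNIFORMLY in `N`.  This file proves that uniformity from a kernel envelope
(`|M(n,m)| ≤ C₀/|n − m|` off the diagonal, `|M(n,n)| ≤ C₁ + C₂ log(1 + n)` on it — `WeilFormatCKernelEnvelope` for Yoshida's
matrix), cube decay of the profile table (`|V(n,j)| ≤ K/n³`, the window polynomials' Fourier coefficients,
`WeilFormatCWindowCoeffDecay`), a uniform positive floor `d₀` of the far diagonal, and the row estimates of
`WeilFormatCDeflatedFarRows`: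

* `abs_coupling_sub_coupling_limit_le` — for `P ≥ B ≥ 1` and EVERY `N`, `x`, `β`:
  `|Σ_{m∈[B,N)} g^P_m(x,β)²/d̂_m − Σ_{m∈[B,N)} g^∞_m(x,β)²/d̂_m| ≤ (8L(C₀B + L)(B + r)/(d₀P))·(Σx² + Σβ²)`
  (`g^P_m = Σ_i M(i,m)x_i + Σ_{n∈[B,P)} M(n,m)(Vβ)_n`, `g^∞_m = Σ_i M(i,m)x_i + Σ_j c∞(m,j)β_j`, `L = (4C₀ + 2C₁ + 2C₂)K`);
* `exists_coupling_approx` — the `ε`-form: `∀ ε > 0 ∃ P₀ ≥ B ∀ P ≥ P₀ ∀ N x β, |…| ≤ ε(Σx² + Σβ²)`;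
* `sum_range_mul_mul_nonneg_of_certificate_deflated_envelope` — the limit wrapper with the coupling clause DISCHARGED: the
  data side supplies a majorant `Uq` of the LIMIT coupling `Σ_{m∈[B,N)} g^∞_m²/d̂_m` (every `N`) and eventual approximations
  of the augmented Gram form (`exists_blockQuadForm_approx`) and of the correction only.

Pure real analysis on sequences; standard axioms; nothing Weil-specific; no RH claim.
-/

-- `Summit.RiemannHypothesis.RiemannHypothesis.…` is the layout-mandated namespace (summit = problem name).
set_option linter.dupNamespace false

namespace Summit.RiemannHypothesis.RiemannHypothesis.Theorems.WeilFormatC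

open Finset Filter Topology

/-! ## The coupling clause, uniformly in the truncation -/

/-- `(Σ_i |x_i| + Σ_j |β_j|)² ≤ 2(B + r)(Σ x_i² + Σ β_j²)`. -/
theorem sq_l1_le {B r : ℕ} (x : Fin B → ℝ) (β : Fin r → ℝ) :
    (∑ i, |x i| + ∑ j, |β j|) ^ 2 ≤ 2 * ((B : ℝ) + r) * (∑ i, x i ^ 2 + ∑ j, β j ^ 2) := by
  have hx : (∑ i, |x i|) ^ 2 ≤ B * ∑ i, x i ^ 2 := by
    have h := Finset.sum_mul_sq_le_sq_mul_sq Finset.univ (fun i ↦ |x i|) (fun _ ↦ (1 : ℝ))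
    simp only [mul_one, one_pow, Finset.sum_const, Finset.card_univ, Fintype.card_fin, nsmul_eq_mul,
      sq_abs] at h
    linarith
  have hb : (∑ j, |β j|) ^ 2 ≤ r * ∑ j, β j ^ 2 := by
    have h := Finset.sum_mul_sq_le_sq_mul_sq Finset.univ (fun j ↦ |β j|) (fun _ ↦ (1 : ℝ))
    simp only [mul_one, one_pow, Finset.sum_const, Finset.card_univ, Fintype.card_fin, nsmul_eq_mul,
      sq_abs] at h
    linarith
  have hB : (0 : ℝ) ≤ B := Nat.cast_nonneg B
  have hr : (0 : ℝ) ≤ r := Nat.cast_nonneg r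
  have hsx : 0 ≤ ∑ i, x i ^ 2 := Finset.sum_nonneg fun i _ ↦ sq_nonneg _
  have hsb : 0 ≤ ∑ j, β j ^ 2 := Finset.sum_nonneg fun j _ ↦ sq_nonneg _
  nlinarith [sq_nonneg (∑ i, |x i| - ∑ j, |β j|), mul_nonneg hB hsb, mul_nonneg hr hsx]

/-- **The coupling clause under the envelope, uniformly in `N` (explicit rate).**  With `L = (4C₀ + 2C₁ + 2C₂)K`, for
`P ≥ B ≥ 1` and every `N`, `x`, `β`:
`|Σ_{m∈[B,N)} (g^P_m)²/d̂_m − Σ_{m∈[B,N)} (g^∞_m)²/d̂_m| ≤ (8L(C₀B + L)(B + r)/(d₀P))·(Σ x² + Σ β²)`,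
`g^P_m = Σ_i M(i,m)x_i + Σ_{n∈[B,P)} M(n,m)Σ_j V(n,j)β_j`, `g^∞_m = Σ_i M(i,m)x_i + Σ_j c∞(m,j)β_j`. -/
theorem abs_coupling_sub_coupling_limit_le (M : ℕ → ℕ → ℝ) {B r : ℕ} (hB : 1 ≤ B) (V : ℕ → Fin r → ℝ)
    (dhat : ℕ → ℝ) {d₀ C₀ C₁ C₂ K : ℝ} (hd₀ : 0 < d₀) (hC₀ : 0 ≤ C₀) (hC₁ : 0 ≤ C₁) (hC₂ : 0 ≤ C₂) (hK : 0 ≤ K)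
    (hd : ∀ m, B ≤ m → d₀ ≤ dhat m)
    (hoff : ∀ n m, n ≠ m → |M n m| ≤ C₀ / |(n : ℝ) - m|)
    (hdiag : ∀ n, |M n n| ≤ C₁ + C₂ * Real.log (1 + n))
    (hV : ∀ n j, B ≤ n → |V n j| ≤ K / (n : ℝ) ^ 3)
    (cinf : ℕ → Fin r → ℝ)
    (hc : ∀ m j, B ≤ m → Tendsto (fun P ↦ ∑ n ∈ Ico B P, M n m * V n j) atTop (𝓝 (cinf m j)))
    {P : ℕ} (hBP : B ≤ P) (N : ℕ) (x : Fin B → ℝ) (β : Fin r → ℝ) :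
    |∑ m ∈ Ico B N, (∑ i : Fin B, M i m * x i + ∑ n ∈ Ico B P, M n m * ∑ j, V n j * β j) ^ 2 / dhat m
      - ∑ m ∈ Ico B N, (∑ i : Fin B, M i m * x i + ∑ j, cinf m j * β j) ^ 2 / dhat m|
      ≤ 8 * ((4 * C₀ + 2 * C₁ + 2 * C₂) * K) * (C₀ * B + (4 * C₀ + 2 * C₁ + 2 * C₂) * K) * ((B : ℝ) + r)
          / (d₀ * P) * (∑ i, x i ^ 2 + ∑ j, β j ^ 2) := by
  set L : ℝ := (4 * C₀ + 2 * C₁ + 2 * C₂) * K with hL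
  have hL0 : 0 ≤ L := by positivity
  have hP1 : 1 ≤ P := hB.trans hBP
  have hP0 : (0 : ℝ) < P := by exact_mod_cast hP1
  set X : ℝ := ∑ i, |x i| with hX
  set Y : ℝ := ∑ j, |β j| with hY
  have hX0 : 0 ≤ X := Finset.sum_nonneg fun i _ ↦ abs_nonneg _
  have hY0 : 0 ≤ Y := Finset.sum_nonneg fun j _ ↦ abs_nonneg _
  -- names for the images
  set cP : ℕ → Fin r → ℝ := fun m j ↦ ∑ n ∈ Ico B P, M n m * V n j with hcP
  set h : ℕ → ℝ := fun m ↦ ∑ i : Fin B, M i m * x i with hh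
  have hgP : ∀ m, ∑ i : Fin B, M i m * x i + ∑ n ∈ Ico B P, M n m * ∑ j, V n j * β j
      = h m + ∑ j, cP m j * β j := by
    intro m
    simp only [hh, hcP]
    congr 1
    simp_rw [Finset.mul_sum, Finset.sum_mul]
    rw [Finset.sum_comm]
    exact Finset.sum_congr rfl fun j _ ↦ Finset.sum_congr rfl fun n _ ↦ by ring
  simp_rw [hgP]
  rw [← Finset.sum_sub_distrib]
  -- termwise bound
  have hterm : ∀ m ∈ Ico B N,
      |(h m + ∑ j, cP m j * β j) ^ 2 / dhat m - (h m + ∑ j, cinf m j * β j) ^ 2 / dhat m|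
        ≤ 2 * L * (C₀ * B + L) / (d₀ * P) * ((X + Y) ^ 2) * (1 / (m : ℝ) ^ 2) := by
    intro m hmN
    have hBm : B ≤ m := (Finset.mem_Ico.1 hmN).1
    have hm1 : 1 ≤ m := hB.trans hBm
    have hm0 : (0 : ℝ) < m := by exact_mod_cast hm1
    have hdm : d₀ ≤ dhat m := hd m hBm
    have hdm0 : 0 < dhat m := lt_of_lt_of_le hd₀ hdm
    -- the two factors
    have hu : |∑ j, cP m j * β j - ∑ j, cinf m j * β j| ≤ L / ((m : ℝ) * P) * Y := by
      rw [← Finset.sum_sub_distrib]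
      calc |∑ j, (cP m j * β j - cinf m j * β j)| ≤ ∑ j, |cP m j * β j - cinf m j * β j| :=
            Finset.abs_sum_le_sum_abs _ _
        _ ≤ ∑ j, L / ((m : ℝ) * P) * |β j| := Finset.sum_le_sum fun j _ ↦ by
            rw [← sub_mul, abs_mul]
            refine mul_le_mul_of_nonneg_right ?_ (abs_nonneg _)
            rw [abs_sub_comm]
            exact abs_cinf_sub_le hC₀ hC₁ hC₂ hK hB hoff hdiag hV hm1 (hc m j hBm) hBP
        _ = L / ((m : ℝ) * P) * Y := by rw [hY, Finset.mul_sum]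
    have hs : |h m + ∑ j, cP m j * β j + (h m + ∑ j, cinf m j * β j)| ≤ 2 * (C₀ * B + L) / (m : ℝ) * (X + Y) := by
      have e1 : |h m| ≤ C₀ * B / (m : ℝ) * X := by
        simp only [hh]
        calc |∑ i : Fin B, M i m * x i| ≤ ∑ i : Fin B, |M i m * x i| := Finset.abs_sum_le_sum_abs _ _
          _ ≤ ∑ i : Fin B, C₀ * B / (m : ℝ) * |x i| := Finset.sum_le_sum fun i _ ↦ by
              rw [abs_mul]
              exact mul_le_mul_of_nonneg_right (abs_block_row_le hC₀ hoff i.isLt hBm) (abs_nonneg _)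
          _ = C₀ * B / (m : ℝ) * X := by rw [hX, Finset.mul_sum]
      have e2 : |∑ j, cP m j * β j| ≤ L / (m : ℝ) * Y := by
        calc |∑ j, cP m j * β j| ≤ ∑ j, |cP m j * β j| := Finset.abs_sum_le_sum_abs _ _
          _ ≤ ∑ j, L / (m : ℝ) * |β j| := Finset.sum_le_sum fun j _ ↦ by
              rw [abs_mul]
              exact mul_le_mul_of_nonneg_right
                (abs_sum_Ico_mul_le hC₀ hC₁ hC₂ hK hB hoff hdiag hV hm1 j P) (abs_nonneg _)
          _ = L / (m : ℝ) * Y := by rw [hY, Finset.mul_sum]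
      have e3 : |∑ j, cinf m j * β j| ≤ L / (m : ℝ) * Y := by
        calc |∑ j, cinf m j * β j| ≤ ∑ j, |cinf m j * β j| := Finset.abs_sum_le_sum_abs _ _
          _ ≤ ∑ j, L / (m : ℝ) * |β j| := Finset.sum_le_sum fun j _ ↦ by
              rw [abs_mul]
              exact mul_le_mul_of_nonneg_right
                (abs_cinf_le hC₀ hC₁ hC₂ hK hB hoff hdiag hV hm1 (hc m j hBm)) (abs_nonneg _)
          _ = L / (m : ℝ) * Y := by rw [hY, Finset.mul_sum]
      have t1 := abs_add_le (h m + ∑ j, cP m j * β j) (h m + ∑ j, cinf m j * β j)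
      have t2 := abs_add_le (h m) (∑ j, cP m j * β j)
      have t3 := abs_add_le (h m) (∑ j, cinf m j * β j)
      have hCB : 0 ≤ C₀ * B / (m : ℝ) * X := by positivity
      have hCB' : C₀ * B / (m : ℝ) * X ≤ C₀ * B / (m : ℝ) * (X + Y) := by
        refine mul_le_mul_of_nonneg_left (by linarith) (by positivity)
      have hLY : L / (m : ℝ) * Y ≤ L / (m : ℝ) * (X + Y) := by
        refine mul_le_mul_of_nonneg_left (by linarith) (by positivity)
      have e : 2 * (C₀ * B + L) / (m : ℝ) * (X + Y) = 2 * (C₀ * B / (m : ℝ) * (X + Y)) + 2 * (L / (m : ℝ) * (X + Y)) := by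
        ring
      rw [e]
      linarith
    -- combine: `a²/d − b²/d = (a − b)(a + b)/d`
    have eq : (h m + ∑ j, cP m j * β j) ^ 2 / dhat m - (h m + ∑ j, cinf m j * β j) ^ 2 / dhat m
        = (∑ j, cP m j * β j - ∑ j, cinf m j * β j) * (h m + ∑ j, cP m j * β j + (h m + ∑ j, cinf m j * β j))
            / dhat m := by
      ring
    rw [eq, abs_div, abs_mul, abs_of_pos hdm0]
    have hnum : |∑ j, cP m j * β j - ∑ j, cinf m j * β j| *
        |h m + ∑ j, cP m j * β j + (h m + ∑ j, cinf m j * β j)|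
        ≤ (L / ((m : ℝ) * P) * Y) * (2 * (C₀ * B + L) / (m : ℝ) * (X + Y)) :=
      mul_le_mul hu hs (abs_nonneg _) (by positivity)
    calc |∑ j, cP m j * β j - ∑ j, cinf m j * β j| *
          |h m + ∑ j, cP m j * β j + (h m + ∑ j, cinf m j * β j)| / dhat m
        ≤ (L / ((m : ℝ) * P) * Y) * (2 * (C₀ * B + L) / (m : ℝ) * (X + Y)) / d₀ := by
          calc _ ≤ (L / ((m : ℝ) * P) * Y) * (2 * (C₀ * B + L) / (m : ℝ) * (X + Y)) / dhat m :=
                div_le_div_of_nonneg_right hnum hdm0.le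
            _ ≤ _ := div_le_div_of_nonneg_left (by positivity) hd₀ hdm
      _ ≤ (L / ((m : ℝ) * P) * (X + Y)) * (2 * (C₀ * B + L) / (m : ℝ) * (X + Y)) / d₀ := by
          gcongr
          linarith
      _ = 2 * L * (C₀ * B + L) / (d₀ * P) * ((X + Y) ^ 2) * (1 / (m : ℝ) ^ 2) := by
          ring
  refine (Finset.abs_sum_le_sum_abs _ _).trans ((Finset.sum_le_sum hterm).trans ?_)
  rw [← Finset.mul_sum]
  have hsum := sum_Ico_inv_sq_le_two_div hB N
  have hB0 : (0 : ℝ) < B := by exact_mod_cast hB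
  have hsum2 : ∑ n ∈ Ico B N, 1 / (n : ℝ) ^ 2 ≤ 2 := hsum.trans (by
    rw [div_le_iff₀ hB0]
    have : (1 : ℝ) ≤ B := by exact_mod_cast hB
    linarith)
  have hsq := sq_l1_le x β
  have hcoef : 0 ≤ 2 * L * (C₀ * B + L) / (d₀ * P) := by positivity
  calc 2 * L * (C₀ * B + L) / (d₀ * P) * (X + Y) ^ 2 * ∑ n ∈ Ico B N, 1 / (n : ℝ) ^ 2
      ≤ 2 * L * (C₀ * B + L) / (d₀ * P) * (2 * ((B : ℝ) + r) * (∑ i, x i ^ 2 + ∑ j, β j ^ 2)) * 2 := by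
        refine mul_le_mul (mul_le_mul_of_nonneg_left hsq hcoef) hsum2
          (Finset.sum_nonneg fun n _ ↦ by positivity) (by positivity)
    _ = 8 * L * (C₀ * B + L) * ((B : ℝ) + r) / (d₀ * P) * (∑ i, x i ^ 2 + ∑ j, β j ^ 2) := by ring

/-- **The coupling clause under the envelope, `ε`-form.**  For every `ε > 0` there is `P₀ ≥ B` such that for all
`P ≥ P₀` and EVERY `N`, `x`, `β`: `|Σ_{m∈[B,N)} (g^P_m)²/d̂_m − Σ_{m∈[B,N)} (g^∞_m)²/d̂_m| ≤ ε(Σx² + Σβ²)`. -/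
theorem exists_coupling_approx (M : ℕ → ℕ → ℝ) {B r : ℕ} (hB : 1 ≤ B) (V : ℕ → Fin r → ℝ)
    (dhat : ℕ → ℝ) {d₀ C₀ C₁ C₂ K : ℝ} (hd₀ : 0 < d₀) (hC₀ : 0 ≤ C₀) (hC₁ : 0 ≤ C₁) (hC₂ : 0 ≤ C₂) (hK : 0 ≤ K)
    (hd : ∀ m, B ≤ m → d₀ ≤ dhat m)
    (hoff : ∀ n m, n ≠ m → |M n m| ≤ C₀ / |(n : ℝ) - m|)
    (hdiag : ∀ n, |M n n| ≤ C₁ + C₂ * Real.log (1 + n))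
    (hV : ∀ n j, B ≤ n → |V n j| ≤ K / (n : ℝ) ^ 3)
    (cinf : ℕ → Fin r → ℝ)
    (hc : ∀ m j, B ≤ m → Tendsto (fun P ↦ ∑ n ∈ Ico B P, M n m * V n j) atTop (𝓝 (cinf m j)))
    {ε : ℝ} (hε : 0 < ε) :
    ∃ P₀ : ℕ, B ≤ P₀ ∧ ∀ P, P₀ ≤ P → ∀ (N : ℕ) (x : Fin B → ℝ) (β : Fin r → ℝ),
      |∑ m ∈ Ico B N, (∑ i : Fin B, M i m * x i + ∑ n ∈ Ico B P, M n m * ∑ j, V n j * β j) ^ 2 / dhat m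
        - ∑ m ∈ Ico B N, (∑ i : Fin B, M i m * x i + ∑ j, cinf m j * β j) ^ 2 / dhat m|
        ≤ ε * (∑ i, x i ^ 2 + ∑ j, β j ^ 2) := by
  set A : ℝ := 8 * ((4 * C₀ + 2 * C₁ + 2 * C₂) * K) * (C₀ * B + (4 * C₀ + 2 * C₁ + 2 * C₂) * K) * ((B : ℝ) + r) / d₀
    with hA
  have hA0 : 0 ≤ A := by positivity
  refine ⟨max B (⌈A / ε⌉₊ + 1), le_max_left _ _, fun P hP N x β ↦ ?_⟩
  have hBP : B ≤ P := (le_max_left _ _).trans hP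
  have hP0 : (0 : ℝ) < P := by exact_mod_cast hB.trans hBP
  have hAP : A / P ≤ ε := by
    have h1 : A / ε ≤ ⌈A / ε⌉₊ := Nat.le_ceil _
    have h2 : (⌈A / ε⌉₊ : ℝ) + 1 ≤ P := by exact_mod_cast (le_max_right _ _).trans hP
    rw [div_le_iff₀ hP0]
    calc A = A / ε * ε := by field_simp
      _ ≤ P * ε := mul_le_mul_of_nonneg_right (by linarith) hε.le
      _ = ε * P := mul_comm _ _
  have h := abs_coupling_sub_coupling_limit_le M hB V dhat hd₀ hC₀ hC₁ hC₂ hK hd hoff hdiag hV cinf hc hBP N x β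
  refine h.trans ?_
  have hz : 0 ≤ ∑ i, x i ^ 2 + ∑ j, β j ^ 2 := by positivity
  have e : 8 * ((4 * C₀ + 2 * C₁ + 2 * C₂) * K) * (C₀ * B + (4 * C₀ + 2 * C₁ + 2 * C₂) * K) * ((B : ℝ) + r)
      / (d₀ * P) = A / P := by
    rw [hA]
    field_simp
  rw [e]
  exact mul_le_mul_of_nonneg_right hAP hz

/-! ## The limit wrapper with the coupling clause discharged -/

/-- **Deflated certificate with limit data under a kernel envelope.**  As
`sum_range_mul_mul_nonneg_of_certificate_deflated_limit`, but the coupling clause is discharged by the envelope: the data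
side gives a symmetric kernel `M` with `|M(n,m)| ≤ C₀/|n − m|` (`n ≠ m`), `|M(n,n)| ≤ C₁ + C₂ log(1 + n)`, a profile table
with `|V(n,j)| ≤ K/n³` (`n ≥ B ≥ 1`), the limit profile images `c∞(m,j) = lim_P Σ_{n∈[B,P)} M(n,m)V(n,j)` (closed forms),
a far diagonal `d̂ ≥ d₀ > 0` with its far inequality, a majorant `Uq` of the LIMIT coupling for every truncation
(`Σ_{m∈[B,N)} (Σ_i M(i,m)x_i + Σ_j c∞(m,j)β_j)²/d̂_m ≤ Uq(x,β)`), eventual `ε`-approximations of the augmented Gram form `Kq`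
and of the correction `Cq` by their finite-`P` expressions, and the kernel inequality with margin `δ`. -/
theorem sum_range_mul_mul_nonneg_of_certificate_deflated_envelope (M : ℕ → ℕ → ℝ) (hsymm : ∀ n m, M n m = M m n)
    {B : ℕ} (hB : 1 ≤ B) {r : ℕ} (V : ℕ → Fin r → ℝ) (dhat : ℕ → ℝ)
    {d₀ C₀ C₁ C₂ K : ℝ} (hd₀ : 0 < d₀) (hC₀ : 0 ≤ C₀) (hC₁ : 0 ≤ C₁) (hC₂ : 0 ≤ C₂) (hK : 0 ≤ K)
    (hd : ∀ m, B ≤ m → d₀ ≤ dhat m)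
    (hfar : ∀ (N : ℕ) (y : ℕ → ℝ),
      ∑ n ∈ Ico B N, dhat n * y n ^ 2 ≤ ∑ n ∈ Ico B N, ∑ m ∈ Ico B N, y n * M n m * y m)
    (hoff : ∀ n m, n ≠ m → |M n m| ≤ C₀ / |(n : ℝ) - m|)
    (hdiag : ∀ n, |M n n| ≤ C₁ + C₂ * Real.log (1 + n))
    (hV : ∀ n j, B ≤ n → |V n j| ≤ K / (n : ℝ) ^ 3)
    (cinf : ℕ → Fin r → ℝ)
    (hc : ∀ m j, B ≤ m → Tendsto (fun P ↦ ∑ n ∈ Ico B P, M n m * V n j) atTop (𝓝 (cinf m j)))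
    (Λ : (Fin B → ℝ) → (Fin r → ℝ) → Fin r → ℝ)
    (Kq Uq Cq : (Fin B → ℝ) → (Fin r → ℝ) → ℝ) {δ : ℝ} (hδ : 0 < δ)
    (hS : ∀ (x : Fin B → ℝ) (β : Fin r → ℝ),
      δ * (∑ i, x i ^ 2 + ∑ j, β j ^ 2) ≤ Kq x β - Uq x β + Cq x β)
    (hUq : ∀ (N : ℕ) (x : Fin B → ℝ) (β : Fin r → ℝ),
      ∑ m ∈ Ico B N, (∑ i : Fin B, M i m * x i + ∑ j, cinf m j * β j) ^ 2 / dhat m ≤ Uq x β)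
    (hKq : ∀ ε : ℝ, 0 < ε → ∃ P₀ : ℕ, ∀ P, P₀ ≤ P → ∀ (x : Fin B → ℝ) (β : Fin r → ℝ),
        |((∑ i : Fin B, ∑ i' : Fin B, x i * x i' * M i i')
          + 2 * (∑ i : Fin B, ∑ j : Fin r, x i * β j * ∑ m ∈ Ico B P, M i m * V m j)
          + (∑ j : Fin r, ∑ j' : Fin r, β j * β j' * ∑ n ∈ Ico B P, ∑ m ∈ Ico B P, V n j * M n m * V m j'))
          - Kq x β| ≤ ε * (∑ i, x i ^ 2 + ∑ j, β j ^ 2))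
    (hCq : ∀ ε : ℝ, 0 < ε → ∃ P₀ : ℕ, ∀ P, P₀ ≤ P → ∀ (x : Fin B → ℝ) (β : Fin r → ℝ),
        |(2 * ∑ j : Fin r, Λ x β j *
            ((β j - ∑ j' : Fin r, (∑ n ∈ Ico B P, V n j * V n j') * β j')
              + ∑ m ∈ Ico B P, V m j * (∑ i : Fin B, M i m * x i + ∑ n ∈ Ico B P, M n m * ∑ j, V n j * β j) / dhat m)
          - ∑ j : Fin r, ∑ j' : Fin r, Λ x β j * Λ x β j' * ∑ m ∈ Ico B P, V m j * V m j' / dhat m)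
          - Cq x β| ≤ ε * (∑ i, x i ^ 2 + ∑ j, β j ^ 2))
    (N : ℕ) (y : ℕ → ℝ) :
    0 ≤ ∑ n ∈ range N, ∑ m ∈ range N, y n * y m * M n m := by
  refine sum_range_mul_mul_nonneg_of_certificate_deflated_limit M hsymm B dhat
    (fun m hm ↦ lt_of_lt_of_le hd₀ (hd m hm)) hfar Λ Kq Uq Cq hδ hS ?_ N y
  intro ε hε
  obtain ⟨P₁, hP₁⟩ := hKq ε hε
  obtain ⟨P₂, hP₂⟩ := hCq ε hε
  obtain ⟨P₃, hBP₃, hP₃⟩ := exists_coupling_approx M hB V dhat hd₀ hC₀ hC₁ hC₂ hK hd hoff hdiag hV cinf hc hε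
  set P : ℕ := max (max P₁ P₂) P₃ with hP
  have h1 : P₁ ≤ P := (le_max_left _ _).trans (le_max_left _ _)
  have h2 : P₂ ≤ P := (le_max_right _ _).trans (le_max_left _ _)
  have h3 : P₃ ≤ P := le_max_right _ _
  refine ⟨P, hBP₃.trans h3, V, hP₁ P h1, fun N' x β ↦ ?_, hP₂ P h2⟩
  have hu := hP₃ P h3 N' x β
  have hU' := hUq N' x β
  rw [abs_le] at hu
  linarith [hu.2]

end Summit.RiemannHypothesis.RiemannHypothesis.Theorems.WeilFormatC
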